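import Summits.Ventures.PackingBounds.ThreePointCert.C10TCert

/-!
# A(10, arccos 1/3) ≤ 135 (three-point bound, kernel-checked): kernel validation of the blocks of (i') and of the `FI` expansion

Framing: lottery ticket; floor = certified bounds/negative ranges. Venture `PackingBounds` (cell
`pub-packcert`), three-point SDP family. Integer data of a feasible point of the Bachoc–Vallentin
semidefinite program (n = 10, s = 1/3, degree d = 8, symmetric
sums of squares), derived by `pub-packcert-sdp/code/cert2lean.py` from the exact rational
certificate `sdp-n10-d8-s1-3-sym.json` of the cell (two independent exact verifiers + referee), in the
units of the kernel checker `ThreePointCert.Check` (soundness `ThreePointCert.Sound`). Generated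
file: plain lists of integers / monomials.
-/

namespace Summit.Ventures.PackingBounds.ThreePointCert.C10T

open Literature.Geometry.DiscreteGeometry Literature.Geometry.DiscreteGeometry.PolyCert PolyCert.SPoly

set_option maxHeartbeats 0 in
/-- Block `Q0`: rows from 0 ((gQ0.z.length - 0) rows) of `zᵀ(LLᵀ)z` added to `[]` give `eQ0` (kernel). -/
theorem okQ0_1 : chunkOK C10T.gQ0 0 (C10T.gQ0.z.length - 0) [] C10T.eQ0 = true := by
  decide +kernel

set_option maxHeartbeats 0 in
/-- Block `Q1`: rows from 0 ((gQ1.z.length - 0) rows) of `zᵀ(LLᵀ)z` added to `[]` give `eQ1` (kernel). -/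
theorem okQ1_1 : chunkOK C10T.gQ1 0 (C10T.gQ1.z.length - 0) [] C10T.eQ1 = true := by
  decide +kernel

set_option maxHeartbeats 0 in
/-- `FI` expansion, blocks [0, 1] (kernel). -/
theorem okF_1 : FchunkOKG C10T.cert.n C10T.cert.d [FBlk.mk 0 C10T.fw0, FBlk.mk 1 C10T.fw1] [] C10T.dFc1 = true := by
  decide +kernel

set_option maxHeartbeats 0 in
/-- `FI` expansion, blocks [2] (kernel). -/
theorem okF_2 : FchunkOKG C10T.cert.n C10T.cert.d [FBlk.mk 2 C10T.fw2] C10T.dFc1 C10T.dFc2 = true := by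
  decide +kernel

set_option maxHeartbeats 0 in
/-- `FI` expansion, blocks [3] (kernel). -/
theorem okF_3 : FchunkOKG C10T.cert.n C10T.cert.d [FBlk.mk 3 C10T.fw3] C10T.dFc2 C10T.dFc3 = true := by
  decide +kernel

set_option maxHeartbeats 0 in
/-- `FI` expansion, blocks [4] (kernel). -/
theorem okF_4 : FchunkOKG C10T.cert.n C10T.cert.d [FBlk.mk 4 C10T.fw4] C10T.dFc3 C10T.dFc4 = true := by
  decide +kernel

set_option maxHeartbeats 0 in
/-- `FI` expansion, blocks [5] (kernel). -/
theorem okF_5 : FchunkOKG C10T.cert.n C10T.cert.d [FBlk.mk 5 C10T.fw5] C10T.dFc4 C10T.dFc5 = true := by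
  decide +kernel

set_option maxHeartbeats 0 in
/-- `FI` expansion, blocks [6, 7, 8] (kernel). -/
theorem okF_6 : FchunkOKG C10T.cert.n C10T.cert.d [FBlk.mk 6 C10T.fw6, FBlk.mk 7 C10T.fw7, FBlk.mk 8 C10T.fw8] C10T.dFc5 C10T.eFP = true := by
  decide +kernel

end Summit.Ventures.PackingBounds.ThreePointCert.C10T
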